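/-
Copyright: public-domain mathematics; typed transcription for the H21 Literature library (cell lit-balaban,
reader/typer seat r02 gen 5 = literature-prover-lit-balaban-r02-g5-0).

statement-level skeleton of published theorems with citation tags; proofs where landed; nothing here is a claim about the Yang–Mills mass gap

# Bałaban, *Propagators and renormalization transformations for lattice gauge theories. I*,
# Commun. Math. Phys. **95** (1984) 17–40 — three-kind REAL SOURCES on the tower and the Prop.-1.1 half for the DIAGONAL
# vector operator `G₀ = ⊕_μ G₀^{(μ)}` (Bałaban's `G₀ = (Δ + aQ*Q)^{−1}` on 1-forms), with the printed weighted norm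

[cite: Balaban1984PropagatorsI]  T. Bałaban, Commun. Math. Phys. 95 (1984) 17–40.  p. 33 Prop. 1.1 (1.89)–(1.90); p. 39 L29 (text-layer count, L1 =
running head; v1.1 wrote "L23", r05 26-(a)): «… and we have Proposition 1.1 for G₀.» (v1.1 DOCSTRING-ONLY, r02 gen 12 QUOTE-AUDIT-B5
item A2: v1 wrote the paraphrase "Proposition 1.1 holds for G₀ also" inside guillemets — not the printed wording; declarations
byte-identical to v1; v1.2 DOCSTRING-ONLY, r02 gen 13: numeral counted, the retired paraphrase de-guillemeted here too —
guillemets in this file = verbatim print only; declarations byte-identical); p. 21 (1.21) (weight η^d); p. 18 (1.3), p. 20 (1.18): A, J real vector functions on T_η, Q acting componentwise.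

WHAT THIS MODULE ADDS (SKELETON rows B5.Eq1.134, B5.Prop1.2 census (iv)/(vii); owner's design note 2026-08-21T10:14Z: a G₀ family
indexed by the torus alone, with the diagonal vector operator and three source kinds, makes the (1.132)/(1.133) carriers
index-for-index).  Setting-free vocabulary + theorems, for whichever seat types that `B5.Setting`:
* §1 `LocT P = vec | ten | ten2` (real sources on `Site P 0`, three kinds as `B5Prop11Lattice.Loc189` / `B5SettingP12Real.LocR`), the
  weighted norm `l2NormT` (p37's `l2Fam` on all indices), supports `suppInT`, sup norm `supNormT`;
* §2 the six norms (1.89) FOR THE DIAGONAL `G₀` kind by kind (`l2opT a m`), via `B5G0BridgeP12.tG0/tD/tDiv/tDiv2`, and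
  **`l2opT_le : l2opT a m J ≤ γ₀(G₀)^{−1}·l2NormT J`** (all six, all kinds; `gammaG0 d a` of p251794) — the weights cancel;
* §3 the forms of (1.90) on real vector fields `formG0inv`/`formLapOne` (weighted `Σ_μ⟨A_μ, M0^{(μ)}A_μ⟩`, `Σ_μ⟨A_μ,(−Δ^ε+1)A_μ⟩`) and
  **`form_ineq190 : γ₀(G₀)·formLapOne A ≤ formG0inv a A`**.
So a tower `B5.Setting` for the diagonal G₀ with `Loc := LocT P`, `l2Norm := l2NormT`, `l2op := l2opT a`, `Vec := Fin d → Site P 0 → ℝ`,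
`formΔa := formG0inv a`, `formΔI := formLapOne` has `B5.Prop11Printed` with `γ₀ = gammaG0 d a` by `l2opT_le` + `form_ineq190`.

HONEST SCOPE.  Transport/bookkeeping of p251794's Prop. 1.1 for G₀ through `B5G0BridgeP12Norms`; nothing analytic.
-/
import Mathlib
import Literature.MathematicalPhysics.QuantumFieldTheory.Balaban1983to89.B5G0BridgeP12Norms
import Literature.MathematicalPhysics.QuantumFieldTheory.Balaban1983to89.B5G0SettingTorus

open scoped BigOperators Matrix Real
open Finset Matrix

namespace Literature.MathematicalPhysics.QuantumFieldTheory.Balaban1983to89.B5TowerSourcesG0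

open Literature.MathematicalPhysics.QuantumFieldTheory.Balaban1983to89
open Literature.MathematicalPhysics.QuantumFieldTheory.Balaban1983to89.B5SiteBridgeP12 (nP MP)
open Literature.MathematicalPhysics.QuantumFieldTheory.Balaban1983to89.B5G0BridgeP12 (tl2 tl2T tG0 tD tDiv tDiv2 towerG0_ineq189_0
  towerG0_ineq189_1 towerG0_ineq189_2 towerG0_ineq189_3 towerG0_ineq189_4 towerG0_ineq189_5 towerG0_ineq190 gammaG0_pos')
open Literature.MathematicalPhysics.QuantumFieldTheory.Balaban1983to89.B5Eq133G0Torus (M0)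
open Literature.MathematicalPhysics.QuantumFieldTheory.Balaban1983to89.B5G0SettingTorus (l2Fam l2Fam_nonneg)
open Literature.MathematicalPhysics.QuantumFieldTheory.Balaban1983to89.B5GpSettingTorus (inCube supN_le_supNormV supNormV supNormV_nonneg)
open Literature.MathematicalPhysics.QuantumFieldTheory.Balaban1983to89.B5Ineq137Torus (supN supN_nonneg)
open Literature.MathematicalPhysics.QuantumFieldTheory.Balaban1983to89.B1RG242Torus (hOp H)
open Literature.MathematicalPhysics.QuantumFieldTheory.Balaban1983to89.B5Prop11G0Torus (gammaG0)

noncomputable section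

variable (P : Params)

/-! ## §1 Three-kind real sources on the tower, weighted norm, supports, sup norm -/

/-- **the real arguments `J` of (1.89)/(1.110)–(1.117) on the tower, three kinds**: a vector function `J_μ(x)`, a tensor function
`T_{νμ}(x)` (for `G∇*T`, `(∇*T)_μ = Σ_ν ∂ᵀ_ν T_{νμ}`), a 3-tensor function (for `G∇*∇*T`). [cite: Balaban1984PropagatorsI, Prop. 1.1 (1.89) p.33] -/
inductive LocT : Type
  | vec (J : Fin P.d → Site P 0 → ℝ)
  | ten (T : Fin P.d → Fin P.d → Site P 0 → ℝ)
  | ten2 (T : Fin P.d × Fin P.d → Fin P.d → Site P 0 → ℝ)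

/-- **the printed weighted norm `‖J‖`** (p37's `l2Fam` over all indices of the kind). [cite: Balaban1984PropagatorsI, (1.89) p.33, (1.21) p.21] -/
def l2NormT (k : ℕ) : LocT P → ℝ
  | .vec J => l2Fam P k J
  | .ten T => l2Fam P k (fun p : Fin P.d × Fin P.d => T p.1 p.2)
  | .ten2 T => l2Fam P k (fun p : (Fin P.d × Fin P.d) × Fin P.d => T p.1 p.2)

/-- **`supp J ⊂ Δ̃(y′)`** (every component). [cite: Balaban1984PropagatorsI, Prop. 1.2 p.35] -/
def suppInT (k : ℕ) : LocT P → Site P k → Prop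
  | .vec J, y' => ∀ μ x, J μ x ≠ 0 → inCube P k x y'
  | .ten T, y' => ∀ ν μ x, T ν μ x ≠ 0 → inCube P k x y'
  | .ten2 T, y' => ∀ p μ x, T p μ x ≠ 0 → inCube P k x y'

/-- **`|J|`** (1.108), max over all indices. [cite: Balaban1984PropagatorsI, (1.108) p.35] -/
def supNormT : LocT P → ℝ
  | .vec J => supNormV P J
  | .ten T => (Finset.univ : Finset (Fin P.d)).sup' ⟨⟨0, P.hd⟩, Finset.mem_univ _⟩ (fun ν => supNormV P (T ν))
  | .ten2 T => (Finset.univ : Finset (Fin P.d × Fin P.d)).sup' ⟨(⟨0, P.hd⟩, ⟨0, P.hd⟩), Finset.mem_univ _⟩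
      (fun p => supNormV P (T p))

/-- `0 ≤ ‖J‖`. [cite: Balaban1984PropagatorsI, (1.89) p.33] -/
theorem l2NormT_nonneg (k : ℕ) (J : LocT P) : 0 ≤ l2NormT P k J := by
  cases J <;> exact l2Fam_nonneg P k _

/-- `0 ≤ |J|`. [cite: Balaban1984PropagatorsI, (1.108) p.35] -/
theorem supNormT_nonneg (J : LocT P) : 0 ≤ supNormT P J := by
  cases J with
  | vec J => exact supNormV_nonneg J
  | ten T => exact (supNormV_nonneg (T ⟨0, P.hd⟩)).trans (Finset.le_sup' (fun ν => supNormV P (T ν)) (Finset.mem_univ _))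
  | ten2 T =>
      refine le_trans (supNormV_nonneg (T (⟨0, P.hd⟩, ⟨0, P.hd⟩))) ?_
      exact Finset.le_sup' (fun p => supNormV P (T p)) (Finset.mem_univ _)

/-! ## §2 The six norms (1.89) for the diagonal `G₀` and their bound -/

/-- **the six norms (1.89) for `G₀ = ⊕_μ G₀^{(μ)}` at the top level** (`m² = 0`), kind by kind: m = 0 `‖G₀J‖`, 1 `‖∇G₀J‖`, 4 `‖∇∇G₀J‖`
on vector sources; 2 `‖G₀∇*T‖`, 3 `‖∇G₀∇*T‖` on tensor sources; 5 `‖G₀∇*∇*T‖` on 3-tensor sources; zero on the other kinds (as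
`B5Prop11G0Torus.l2opG0`). [cite: Balaban1984PropagatorsI, Prop. 1.1 (1.89) p.33, p.39] -/
def l2opT (a : ℝ) (m : Fin 6) : LocT P → ℝ
  | .vec J => (![l2Fam P P.K (tG0 P a J),
      l2Fam P P.K (fun p : Fin P.d × Fin P.d => tD P p.1 (tG0 P a J) p.2), 0, 0,
      l2Fam P P.K (fun p : (Fin P.d × Fin P.d) × Fin P.d => tD P p.1.1 (tD P p.1.2 (tG0 P a J)) p.2), 0] : Fin 6 → ℝ) m
  | .ten T => (![0, 0, l2Fam P P.K (tG0 P a (tDiv P T)),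
      l2Fam P P.K (fun p : Fin P.d × Fin P.d => tD P p.1 (tG0 P a (tDiv P T)) p.2), 0, 0] : Fin 6 → ℝ) m
  | .ten2 T => (![0, 0, 0, 0, 0, l2Fam P P.K (tG0 P a (tDiv2 P T))] : Fin 6 → ℝ) m

/-- the weighted norm is `η^{d/2}` times the plain one: `l2Fam K F = √(η^d)·√(Σ F²)`. [cite: Balaban1984PropagatorsI, (1.21) p.21] -/
theorem l2Fam_eq_mul {ι : Type} [Fintype ι] (F : ι → Site P 0 → ℝ) :
    l2Fam P P.K F = Real.sqrt ((((P.L : ℝ) ^ P.K)⁻¹) ^ P.d) * Real.sqrt (∑ i, ∑ x, F i x ^ 2) := by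
  rw [l2Fam, ← Real.sqrt_mul (by positivity), Finset.mul_sum]
  congr 1
  exact Finset.sum_congr rfl fun i _ => by rw [Finset.mul_sum]

/-- `tl2 F = √(Σ_μ Σ_x F²)` read as an `l2Fam` without weight bookkeeping. [cite: Balaban1984PropagatorsI, (1.89) p.33] -/
theorem l2Fam_vec_eq (F : Fin P.d → Site P 0 → ℝ) :
    l2Fam P P.K F = Real.sqrt ((((P.L : ℝ) ^ P.K)⁻¹) ^ P.d) * tl2 P F := by
  rw [l2Fam_eq_mul, tl2]

/-- the same for a family indexed by `S × Fin d` (a tensor uncurried). [cite: Balaban1984PropagatorsI, (1.89) p.33] -/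
theorem l2Fam_prod_eq {S : Type} [Fintype S] (F : S × Fin P.d → Site P 0 → ℝ) :
    l2Fam P P.K F = Real.sqrt ((((P.L : ℝ) ^ P.K)⁻¹) ^ P.d) * Real.sqrt (∑ s, ∑ μ, ∑ x, F (s, μ) x ^ 2) := by
  rw [l2Fam_eq_mul, Fintype.sum_prod_type]

variable {P}

/-- **(1.89) FOR THE DIAGONAL `G₀`, ALL SIX NORMS, ALL KINDS**: `l2opT a m J ≤ γ₀(G₀)^{−1}‖J‖` (`a > 0`).
[cite: Balaban1984PropagatorsI, Prop. 1.1 (1.89) p.33, p.39 L29 («we have Proposition 1.1 for G₀»)] -/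
theorem l2opT_le {a : ℝ} (ha : 0 < a) (m : Fin 6) (J : LocT P) :
    l2opT P a m J ≤ (gammaG0 P.d a)⁻¹ * l2NormT P P.K J := by
  have hγ : 0 ≤ (gammaG0 P.d a)⁻¹ := inv_nonneg.mpr (gammaG0_pos' ha.le).le
  have hw : 0 ≤ Real.sqrt ((((P.L : ℝ) ^ P.K)⁻¹) ^ P.d) := Real.sqrt_nonneg _
  have h0 : ∀ J : LocT P, (0 : ℝ) ≤ (gammaG0 P.d a)⁻¹ * l2NormT P P.K J := fun J => mul_nonneg hγ (l2NormT_nonneg P _ J)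
  -- the weighted form of a plain bound `X ≤ γ⁻¹ Y`
  have lift : ∀ {X Y : ℝ}, X ≤ (gammaG0 P.d a)⁻¹ * Y →
      Real.sqrt ((((P.L : ℝ) ^ P.K)⁻¹) ^ P.d) * X ≤ (gammaG0 P.d a)⁻¹ * (Real.sqrt ((((P.L : ℝ) ^ P.K)⁻¹) ^ P.d) * Y) := by
    intro X Y h
    calc Real.sqrt ((((P.L : ℝ) ^ P.K)⁻¹) ^ P.d) * X ≤ Real.sqrt ((((P.L : ℝ) ^ P.K)⁻¹) ^ P.d) * ((gammaG0 P.d a)⁻¹ * Y) :=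
          mul_le_mul_of_nonneg_left h hw
      _ = _ := by ring
  cases J with
  | vec J =>
      fin_cases m
      · show l2Fam P P.K (tG0 P a J) ≤ (gammaG0 P.d a)⁻¹ * l2Fam P P.K J
        rw [l2Fam_vec_eq, l2Fam_vec_eq]
        exact lift (towerG0_ineq189_0 P ha J)
      · show l2Fam P P.K (fun p : Fin P.d × Fin P.d => tD P p.1 (tG0 P a J) p.2) ≤ (gammaG0 P.d a)⁻¹ * l2Fam P P.K J
        rw [l2Fam_prod_eq, l2Fam_vec_eq]
        exact lift (towerG0_ineq189_1 P ha J)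
      · exact h0 (.vec J)
      · exact h0 (.vec J)
      · show l2Fam P P.K (fun p : (Fin P.d × Fin P.d) × Fin P.d => tD P p.1.1 (tD P p.1.2 (tG0 P a J)) p.2)
          ≤ (gammaG0 P.d a)⁻¹ * l2Fam P P.K J
        rw [l2Fam_prod_eq, l2Fam_vec_eq]
        exact lift (towerG0_ineq189_4 P ha J)
      · exact h0 (.vec J)
  | ten T =>
      fin_cases m
      · exact h0 (.ten T)
      · exact h0 (.ten T)
      · show l2Fam P P.K (tG0 P a (tDiv P T)) ≤ (gammaG0 P.d a)⁻¹ * l2Fam P P.K (fun p : Fin P.d × Fin P.d => T p.1 p.2)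
        rw [l2Fam_vec_eq, l2Fam_prod_eq]
        exact lift (towerG0_ineq189_2 P ha T)
      · show l2Fam P P.K (fun p : Fin P.d × Fin P.d => tD P p.1 (tG0 P a (tDiv P T)) p.2)
          ≤ (gammaG0 P.d a)⁻¹ * l2Fam P P.K (fun p : Fin P.d × Fin P.d => T p.1 p.2)
        rw [l2Fam_prod_eq, l2Fam_prod_eq]
        exact lift (towerG0_ineq189_3 P ha T)
      · exact h0 (.ten T)
      · exact h0 (.ten T)
  | ten2 T =>
      fin_cases m
      · exact h0 (.ten2 T)
      · exact h0 (.ten2 T)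
      · exact h0 (.ten2 T)
      · exact h0 (.ten2 T)
      · exact h0 (.ten2 T)
      · show l2Fam P P.K (tG0 P a (tDiv2 P T))
          ≤ (gammaG0 P.d a)⁻¹ * l2Fam P P.K (fun p : (Fin P.d × Fin P.d) × Fin P.d => T p.1 p.2)
        rw [l2Fam_vec_eq, l2Fam_prod_eq]
        exact lift (towerG0_ineq189_5 P ha T)

variable (P)

/-! ## §3 The forms of (1.90) on real vector fields -/

/-- **`⟨A, (Δ + aQ*Q)A⟩` for the diagonal `G₀^{−1}`**, weighted: `η^d Σ_μ ⟨A_μ, M0^{(μ)}A_μ⟩`. [cite: Balaban1984PropagatorsI, (1.90) p.33, (1.132) p.39] -/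
def formG0inv (a : ℝ) (A : Fin P.d → Site P 0 → ℝ) : ℝ :=
  (((P.L : ℝ) ^ P.K)⁻¹) ^ P.d * ∑ μ, A μ ⬝ᵥ (M0 P a 0 P.K μ *ᵥ A μ)

/-- **`⟨A, (Δ + I)A⟩`**, weighted: `η^d Σ_μ ⟨A_μ, (−Δ^ε + 1)A_μ⟩`. [cite: Balaban1984PropagatorsI, (1.90) p.33] -/
def formLapOne (A : Fin P.d → Site P 0 → ℝ) : ℝ :=
  (((P.L : ℝ) ^ P.K)⁻¹) ^ P.d * ∑ μ, A μ ⬝ᵥ ((H P 0 + 1) *ᵥ A μ)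

variable {P}

/-- **(1.90) FOR THE DIAGONAL `G₀`**: `γ₀(G₀)·⟨A,(Δ+I)A⟩ ≤ ⟨A,(Δ + aQ*Q)A⟩` (`a > 0`). [cite: Balaban1984PropagatorsI, Prop. 1.1 (1.90) p.33, p.39] -/
theorem form_ineq190 {a : ℝ} (ha : 0 < a) (A : Fin P.d → Site P 0 → ℝ) :
    gammaG0 P.d a * formLapOne P A ≤ formG0inv P a A := by
  unfold formLapOne formG0inv
  have hw : 0 ≤ (((P.L : ℝ) ^ P.K)⁻¹) ^ P.d := by positivity
  have hH : hOp P 0 P.eps 1 = H P 0 + 1 := by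
    rw [H, hOp, hOp, zero_smul, zero_add, one_smul, add_comm]
  have h := towerG0_ineq190 P ha A
  rw [hH] at h
  calc gammaG0 P.d a * ((((P.L : ℝ) ^ P.K)⁻¹) ^ P.d * ∑ μ, A μ ⬝ᵥ ((H P 0 + 1) *ᵥ A μ))
      = (((P.L : ℝ) ^ P.K)⁻¹) ^ P.d * (gammaG0 P.d a * ∑ μ, A μ ⬝ᵥ ((H P 0 + 1) *ᵥ A μ)) := by ring
    _ ≤ (((P.L : ℝ) ^ P.K)⁻¹) ^ P.d * ∑ μ, A μ ⬝ᵥ (M0 P a 0 P.K μ *ᵥ A μ) := mul_le_mul_of_nonneg_left h hw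

end

end Literature.MathematicalPhysics.QuantumFieldTheory.Balaban1983to89.B5TowerSourcesG0
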